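import Summits.NavierStokesRegularity.FluidComputer.PalasekTowerStrainDoorAtSharp
import Summits.NavierStokesRegularity.FluidComputer.PalasekTowerStrainH2ShadowedRun

/-!
# THE STRAIN DOOR AT ARBITRARY RATES `R`, V: the `H²`-CURRENCY certificate letter (route (B)) and its
# composition into `EpisodeBaseGAt R` — no `h^{-3/4}` smoothing loss, fee `e^{(Λ₁+Λ₂)/4}`·(defects)^{1/4}

Cell `ns-blowup`, seat `ns-palasek-20303-p1` (LEAD prover on stmt-NavierStokesRegularity-20303 `EpisodeBaseT`; route
`PalasekTowerBreakdown`, rev 19; line `straindoor` at `tuned`). Sequel of `PalasekTowerStrainDoorAt{,Sharp,Raw,Price}.lean`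
and `PalasekTowerStrainH2ShadowedRun.lean`. LABEL: E–C typing (one open `Prop`-valued structure parametrised by the rates
record — the route-(B) certificate letter — and its sorry-free composition). WHAT THIS IS NOT: not Navier–Stokes
evidence — nothing is inhabited; no run, design or certificate is exhibited; the letter is OPEN at `R = tuned`.

* `CertificateDataH2 R …` — **ONE STRAIN CERTIFICATE IN `H²` CURRENCY at the rates `R`**: an explicit datum `U`
  (smooth, divergence free, `tsupport U ⊆ B̄(0,ρ)`, speed `< Y₀(R)`), a reference run `(w, ϖ)` on the shifted window clock
  `[0, wfirstAt R]` forced by its defect `r` (`r(t), Dr(t) ∈ L²`), Tao's `L²`-Sobolev class, speed `≤ B_w`, and EXACTLY the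
  majorant data of the `H²` existence door `StrainShadowH2.exists_freeRun_near_of_strainH2` (continuous `G ≥ 0` = maximal
  compression rate, `σ₂`, `σ₃`, residual size `R_r`, the `L²`-stage envelope `L ≥ (E₀ + ∫R_r)e^{∫G}`, `H₁`, `ψ₁`, `ψ₂`,
  `X₁`, numbers `κ, μ > 0`, datum defects `E₀, D₁, D₂`, window integrals `Ψ₁, Ψ₂`, the two HALF-smallness inequalities,
  the `X₁` domination, the readout domination `A(3X₁(t)·2e^{Λ₂(t)}(D₂+Ψ₂))^{1/4} ≤ δ`), plus the four explicit readouts of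
  the slice `w(wfirstAt R)` with margins `η + δ`. Compared with `RawCertificateData` (route (A)) there is NO short window `h`
  and NO `(24·9.03·(2B_w+1))²h ≤ 1`: the defect enters at `H¹`/`H²` level instead (no twenty-digit loss), at the price of
  the Hessian / third-derivative majorants of the reference in the exponent. The Agmon constant `A = agmonConst` is NOT
  numeric today: a COMPUTATION cannot check the three fields that contain it until the vein is re-threaded with the explicit
  `√2/π` (19179-p2 g6) — this letter is the TYPE the numeral twin will copy.
* **`episodeBaseGAt_of_mechanismDoorAt_of_certificateDataH2`** — `MechanismDoorAt R → CertificateDataH2 R … → EpisodeBaseGAt R`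
  (the `H²` door, then the currency-free core `episodeBaseGAt_of_mechanismDoorAt_of_nearFreeRun`, p530553).

References: [cite: RobinsonRodrigoSadowskiCUP2016, Thm 9.1 and Thm 1.20]; [cite: DashtiRobinson2008, Thm 1, Thm 2];
[cite: Tao2011, Thm. 5.4 (ii)+(iv)]; [cite: Palasek2026ElementaryModel, §4].
-/

noncomputable section

namespace Summit.NavierStokesRegularity.FluidComputer.PalasekTowerClayBridge.StrainDoor

open Set MeasureTheory Metric Function InnerProductSpace
open scoped ENNReal NNReal ContDiff RealInnerProductSpace
open Literature.Analysis Literature.Analysis.FluidPDE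

/-- **The data of ONE STRAIN CERTIFICATE IN `H²` CURRENCY at the rates `R`** (route (B); see the module docstring for the
reading of each group of fields). [cite: RobinsonRodrigoSadowskiCUP2016, Thm 9.1 and Thm 1.20] [cite: DashtiRobinson2008, Thm 1, Thm 2] -/
structure CertificateDataH2 (R : TowerRates)
    (U : EuclideanSpace ℝ (Fin 3) → EuclideanSpace ℝ (Fin 3)) (ρ : ℝ)
    (w r : ℝ → EuclideanSpace ℝ (Fin 3) → EuclideanSpace ℝ (Fin 3)) (ϖ : ℝ → EuclideanSpace ℝ (Fin 3) → ℝ)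
    (G σ₂ σ₃ Rr L H₁ ψ₁ ψ₂ X₁ : ℝ → ℝ) (Bw E₀ κ μ D₁ Ψ₁ D₂ Ψ₂ δ η : ℝ) : Prop where
  /-- datum statics -/
  datum_smooth : ContDiff ℝ ∞ U
  datum_divFree : VectorCalculus.IsDivFree U
  datum_support : tsupport U ⊆ closedBall 0 ρ
  datum_lt : ∀ x, ‖U x‖ < R.Y 0
  radius_nonneg : 0 ≤ ρ
  /-- the reference run forced by its defect `r`, Tao's class, `r(t), Dr(t) ∈ L²`, speed bound -/
  run : IsClassicalNSSolutionOn (Icc 0 (Host.wfirstAt R)) 1 r w ϖ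
  sobolev : HasBoundedSobolevNormsOn (Icc 0 (Host.wfirstAt R)) w
  sobolev_t : HasBoundedSobolevNormsOn (Icc 0 (Host.wfirstAt R)) (FluidPDE.timeDerivWithin (Icc 0 (Host.wfirstAt R)) w)
  pressure : ∀ n : ℕ, ∃ C' : ℝ≥0, ∀ t ∈ Icc 0 (Host.wfirstAt R), ∫⁻ x, ‖iteratedFDeriv ℝ n (ϖ t) x‖ₑ ^ 2 ≤ C'
  residual_L2 : ∀ t ∈ Icc 0 (Host.wfirstAt R), ∫⁻ x, ‖r t x‖ₑ ^ 2 < ⊤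
  residual_D : ∀ t ∈ Icc 0 (Host.wfirstAt R), ∫⁻ x, ‖fderiv ℝ (r t) x‖ₑ ^ 2 < ⊤
  speed_bdd : ∀ t ∈ Icc 0 (Host.wfirstAt R), ∀ y, ‖w t y‖ ≤ Bw
  /-- majorants: compression rate `G ≥ 0`, Hessian `σ₂`, third derivative `σ₃`, residual size `R_r`, `L²` envelope `L`,
  residual gradient `H₁`, the two source terms `ψ₁, ψ₂`, the `H¹` envelope `X₁`; `κ, μ > 0` -/
  κ_pos : 0 < κ
  μ_pos : 0 < μ
  strain : ∀ s ∈ Icc 0 (Host.wfirstAt R), ∀ (x ξ : EuclideanSpace ℝ (Fin 3)), -⟪fderiv ℝ (w s) x ξ, ξ⟫ ≤ G s * ‖ξ‖ ^ 2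
  G_nonneg : ∀ s ∈ Icc 0 (Host.wfirstAt R), 0 ≤ G s
  hess : ∀ s ∈ Icc 0 (Host.wfirstAt R), ∀ x, ‖iteratedFDeriv ℝ 2 (w s) x‖ ≤ σ₂ s
  third : ∀ s ∈ Icc 0 (Host.wfirstAt R), ∀ x, ‖iteratedFDeriv ℝ 3 (w s) x‖ ≤ σ₃ s
  Rr_nonneg : ∀ s ∈ Icc 0 (Host.wfirstAt R), 0 ≤ Rr s
  residual_two : ∀ s ∈ Icc 0 (Host.wfirstAt R), ∫ x, ‖r s x‖ ^ 2 ≤ Rr s ^ 2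
  L_def : ∀ s ∈ Icc 0 (Host.wfirstAt R), (E₀ + ∫ τ in (0 : ℝ)..s, Rr τ) * Real.exp (∫ τ in (0 : ℝ)..s, G τ) ≤ L s
  H₁_def : ∀ s ∈ Icc 0 (Host.wfirstAt R), ∫ x, ‖fderiv ℝ (fun y => r s y - (0 : EuclideanSpace ℝ (Fin 3))) x‖ ^ 2 ≤ H₁ s
  ψ₁_def : ∀ s ∈ Icc 0 (Host.wfirstAt R), 2 / 1 * (∫ x, ‖r s x - (0 : EuclideanSpace ℝ (Fin 3))‖ ^ 2) +
    3 * σ₂ s / κ * L s ^ 2 ≤ ψ₁ s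
  ψ₂_def : ∀ s ∈ Icc 0 (Host.wfirstAt R), 27 * σ₂ s / κ * X₁ s + 9 * σ₃ s / κ ^ 2 * L s ^ 2 + 6 / 1 * H₁ s ≤ ψ₂ s
  G_cont : ContinuousOn G (Icc 0 (Host.wfirstAt R))
  σ₂_cont : ContinuousOn σ₂ (Icc 0 (Host.wfirstAt R))
  σ₃_cont : ContinuousOn σ₃ (Icc 0 (Host.wfirstAt R))
  Rr_cont : ContinuousOn Rr (Icc 0 (Host.wfirstAt R))
  L_cont : ContinuousOn L (Icc 0 (Host.wfirstAt R))
  X₁_cont : ContinuousOn X₁ (Icc 0 (Host.wfirstAt R))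
  H₁_cont : ContinuousOn H₁ (Icc 0 (Host.wfirstAt R))
  ψ₁_cont : ContinuousOn ψ₁ (Icc 0 (Host.wfirstAt R))
  ψ₂_cont : ContinuousOn ψ₂ (Icc 0 (Host.wfirstAt R))
  /-- datum defects at `L²`, `H¹`, `H²` level and the window integrals of the source terms -/
  E₀_nonneg : 0 ≤ E₀
  datum_two : ∫ x, ‖U x - w 0 x‖ ^ 2 ≤ E₀ ^ 2
  datum_H1 : ∫ x, frobeniusNormSq (fderiv ℝ (fun y => U y - w 0 y) x) ≤ D₁
  datum_H2 : (∑ i, ∫ x, frobeniusNormSq (fderiv ℝ (fun y => fderiv ℝ (fun z => U z - w 0 z) y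
    (EuclideanSpace.basisFun (Fin 3) ℝ i)) x)) ≤ D₂
  Ψ₁_def : ∫ s in (0 : ℝ)..Host.wfirstAt R, ψ₁ s ≤ Ψ₁
  Ψ₂_def : ∫ s in (0 : ℝ)..Host.wfirstAt R, ψ₂ s ≤ Ψ₂
  /-- the two HALF-smallness inequalities, the `X₁` domination and the readout domination (these three contain
  `agmonConst`, non-numeric today) -/
  half₁ : 2 * (agmonConst ^ 4 / (2 * (1 : ℝ) ^ 3) *
      Real.exp (2 * ∫ s in (0 : ℝ)..Host.wfirstAt R, (4 * G s + 3 * κ * σ₂ s))) * (D₁ + Ψ₁) ^ 2 *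
      (Host.wfirstAt R - 0) ≤ 1 / 2
  X₁_dom : ∀ s ∈ Icc 0 (Host.wfirstAt R),
    Real.sqrt 2 * (Real.exp (∫ τ in (0 : ℝ)..s, (4 * G τ + 3 * κ * σ₂ τ)) * (D₁ + Ψ₁)) ≤ X₁ s
  half₂ : agmonConst ^ 2 * μ / 1 *
      Real.exp (∫ s in (0 : ℝ)..Host.wfirstAt R, (6 * G s + 9 * κ * σ₂ s + 3 * κ ^ 2 * σ₃ s +
        3 * agmonConst ^ 2 * X₁ s / (1 * μ) + 27 * agmonConst ^ 4 * X₁ s ^ 2 / (16 * (1 : ℝ) ^ 3))) *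
      (D₂ + Ψ₂) * (Host.wfirstAt R - 0) ≤ 1 / 2
  readout_le : ∀ t ∈ Icc 0 (Host.wfirstAt R), agmonConst * (3 * X₁ t *
    (2 * (Real.exp (∫ s in (0 : ℝ)..t, (6 * G s + 9 * κ * σ₂ s + 3 * κ ^ 2 * σ₃ s +
        3 * agmonConst ^ 2 * X₁ s / (1 * μ) + 27 * agmonConst ^ 4 * X₁ s ^ 2 / (16 * (1 : ℝ) ^ 3))) *
      (D₂ + Ψ₂)))) ^ (1 / 4 : ℝ) ≤ δ
  /-- the four explicit readouts with margins `η + δ`, `η > 0` -/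
  η_pos : 0 < η
  cap : ∀ t ∈ Icc 0 (Host.wfirstAt R), ∀ x, ‖w t x‖ ≤ 5 / 3 * R.Y 1 - η - δ
  speed : ∃ x, ‖x‖ ≤ ρ ∧ R.Y 1 + η + δ ≤ ‖w (Host.wfirstAt R) x‖
  strainFD : ∃ x₀ x₁, ‖x₀‖ ≤ ρ ∧ ‖x₁‖ ≤ ρ ∧
    (R.A 1 + η) * ‖x₁ - x₀‖ + 2 * δ < ‖w (Host.wfirstAt R) x₁ - w (Host.wfirstAt R) x₀‖
  core : ∃ (x : EuclideanSpace ℝ (Fin 3)) (γ : ℝ → EuclideanSpace ℝ (Fin 3)),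
    ‖x‖ ≤ ρ ∧ ContDiff ℝ 1 γ ∧ γ 0 = γ 1 ∧
    (∀ s ∈ Icc (0 : ℝ) 1, γ s ∈ closedBall x (1 / R.N 1)) ∧
    (∀ s ∈ Icc (0 : ℝ) 1, ‖deriv γ s‖ ≤ 8 * Real.pi / R.N 1) ∧
    R.N 1 ^ (R.β - 2) + η + δ * (8 * Real.pi / R.N 1) ≤ circulation (w (Host.wfirstAt R)) γ

variable {R : TowerRates}

/-- **THE `H²`-CURRENCY STRAIN DOOR AT `R`, COMPOSED (route (B))**: the mechanism door at `R` and one `H²`-currency strain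
certificate at `R` give `EpisodeBaseGAt R` (`StrainShadowH2.exists_freeRun_near_of_strainH2`, then
`episodeBaseGAt_of_mechanismDoorAt_of_nearFreeRun`). [cite: RobinsonRodrigoSadowskiCUP2016, Thm 9.1 and Thm 1.20]
[cite: Tao2011, Thm. 5.4 (ii)+(iv)] [cite: Palasek2026ElementaryModel, §4] -/
theorem episodeBaseGAt_of_mechanismDoorAt_of_certificateDataH2 (hdoor : MechanismDoorAt R)
    {U : EuclideanSpace ℝ (Fin 3) → EuclideanSpace ℝ (Fin 3)} {ρ : ℝ}
    {w r : ℝ → EuclideanSpace ℝ (Fin 3) → EuclideanSpace ℝ (Fin 3)} {ϖ : ℝ → EuclideanSpace ℝ (Fin 3) → ℝ}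
    {G σ₂ σ₃ Rr L H₁ ψ₁ ψ₂ X₁ : ℝ → ℝ} {Bw E₀ κ μ D₁ Ψ₁ D₂ Ψ₂ δ η : ℝ}
    (c : CertificateDataH2 R U ρ w r ϖ G σ₂ σ₃ Rr L H₁ ψ₁ ψ₂ X₁ Bw E₀ κ μ D₁ Ψ₁ D₂ Ψ₂ δ η) :
    EpisodeBaseGAt R := by
  have hUc : HasCompactSupport U :=
    IsCompact.of_isClosed_subset (isCompact_closedBall (0 : EuclideanSpace ℝ (Fin 3)) ρ)
      (isClosed_tsupport U) c.datum_support
  obtain ⟨v', q', hv', hv'0, hv'E, hnear'⟩ :=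
    StrainShadowH2.exists_freeRun_near_of_strainH2 (Host.wfirstAt_pos R) c.run c.sobolev c.sobolev_t c.pressure
      c.residual_L2 c.residual_D c.speed_bdd c.κ_pos c.μ_pos c.strain c.G_nonneg c.hess c.third c.Rr_nonneg c.residual_two
      c.L_def c.H₁_def c.ψ₁_def c.ψ₂_def c.G_cont c.σ₂_cont c.σ₃_cont c.Rr_cont c.L_cont c.X₁_cont c.H₁_cont c.ψ₁_cont
      c.ψ₂_cont c.datum_smooth hUc c.datum_divFree c.E₀_nonneg c.datum_two c.datum_H1 c.datum_H2 c.Ψ₁_def c.Ψ₂_def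
      c.half₁ c.X₁_dom c.half₂ c.readout_le
  have hslice : Continuous (w (Host.wfirstAt R)) :=
    (c.run.contDiff_velocity ⟨(Host.wfirstAt_pos R).le, le_rfl⟩).continuous
  exact episodeBaseGAt_of_mechanismDoorAt_of_nearFreeRun hdoor c.datum_smooth c.datum_divFree c.datum_support
    c.datum_lt c.radius_nonneg hv' hv'0 hv'E hnear' c.η_pos hslice c.cap c.speed c.strainFD c.core

end Summit.NavierStokesRegularity.FluidComputer.PalasekTowerClayBridge.StrainDoor

end
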